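import Literature.MathematicalPhysics.QuantumFieldTheory.Balaban1983to89.B6SectAOperatorsV1
import Literature.MathematicalPhysics.QuantumFieldTheory.Balaban1983to89.B6SectAZeroModesV1

/-!
# `Balaban1983to89.B6SectAVectorModelV1` — T. Bałaban, *Propagators and renormalization transformations for lattice gauge
# theories. II*, Commun. Math. Phys. **96** (1984) 223–250 [Balaban1984PropagatorsII], Sect. A pp. 226–228 ON THE V1
# MULTI-LEVEL TORUS CALCULUS: **`Δ_a` (2.19) IS POSITIVE DEFINITE** (p. 226 *"the operator Δ_a is bounded from below by a
# positive constant"* — here: `⟨A, Δ_aA⟩ > 0` for `A ≠ 0` on every finite torus, hence `Δ_a` is invertible), the propagator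
# **`G = Δ_a⁻¹`** (2.22), and **`(QGQ*)⁻¹`** (p. 228 *"The operator G is positive, hence QGQ* is positive also and an inverse
# is a well-defined and positive operator"*)

statement-level skeleton of published theorems with citation tags; proofs where landed; nothing here is a claim about the
Yang–Mills mass gap

PDF held: `paper:balaban1984-cmp96-propagators-rt-ii` (journal page = PDF page + 222); pp. 224–228 read AS IMAGES on the ×2
renders `run/shared/lean/pub/pub-balaban/b2b-balaban-ref1/pages/1984-cmp96-propagators-rt-II/…-p002…p006-x2.png` (this seat).

CITATION HEADER (lean-in-tree rule).  Cell `lit-balaban` (HOME `run/shared/lean/pub/lit-balaban/`), PHASE-2 proof seat **p21**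
(gen 5), B6 fold owner r03, referee ref-4; file 5 of 6 of r03's ranked Phase-2 target P2 (files: `…B6SectADomainsV1`,
`…B6SectAZeroModesV1`, `…B6SectAOntoV1`, `…B6SectAOperatorsV1`, this file, `…B6SectACriticalPointV1`).  WHAT IS REPRODUCED:
SKELETON rows **B6.Eq2.19** (Δ_a; its positivity in the qualitative form `⟨A, Δ_aA⟩ > 0`, `A ≠ 0` — the uniform lower bound
`γ > 0` independent of the volume is Sect. B/C's business and is NOT claimed here), **B6.Eq2.22** (`G = Δ_a⁻¹`), **B6.Eq2.35**
(`(QGQ*)⁻¹` well defined and positive).  Inputs BY NAME: file 4's operators and `R`, file 2's zero-mode theorem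
`…B6SectAZeroModesV1.eq_zero_of_curl_constr_eq29`, file 3's `…B6SectAOntoV1.exists_constr` (`Q` onto); Mathlib's
`LinearEquiv.ofInjectiveEndo` (inverse of an injective endomorphism of a finite-dimensional space).

PRINT (pp. 226, 228, verbatim).  p. 226: *"h(A, λ, ω) = ½⟨A, Δ_aA⟩ − ⟨∂Rλ, A⟩ − ⟨Q*ω, A⟩ + ⟨ω, B⟩ − ½a⟨B, B⟩, (2.18) where
Δ_a = ∂*∂ + ∂R∂* + Q*aQ = Δ − ∂P∂* + Q*aQ, (2.19) … One of our main results will be that the operator Δ_a is bounded from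
below by a positive constant, hence the first equation implies A = G∂Rλ + GQ*ω, (2.22) where G = Δ_a⁻¹."*; p. 228: *"The
operator G is positive, hence QGQ* is positive also and an inverse is a well-defined and positive operator. We get
ω = (QGQ*)⁻¹B … The only assumption we have used was the positivity of the operator Δ_a, a > 0, or G."*

WHAT IS PROVED (0 sorry, 0 new named facts; axioms standard; every nested family `D : Domains P`, lattice factor `c ≠ 0`,
weights `w > 0` on `𝔅`).  §3 **(2.19)** `deltaAE = ∂*∂ + ∂R∂* + Q*aQ` (`rfl`-unfolding `deltaAE_def`), its form
`⟨A′, Δ_aA⟩ = ⟨∂A′, ∂A⟩ + ⟨∂*A′, R∂*A⟩ + ⟨QA′, aQA⟩` (`inner_deltaAE_right`), symmetry, `⟨A, Δ_aA⟩ = ‖∂A‖² + ‖R∂*A‖² + Σ_𝔅 w|QA|²`,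
and **positivity** `deltaAE_pos`: `A ≠ 0 ⇒ ⟨A, Δ_aA⟩ > 0` (the three squares vanish only if `∂A = 0`, `QA = 0`, `R∂*A = 0`,
and then `A = 0` by file 2), hence `Δ_a` injective and bijective.  §4 **`G = Δ_a⁻¹`** (`GE`; `GΔ_a = Δ_aG = 1`, symmetric,
*"G is positive"* `inner_GE_pos`).  §5 `Q` onto ⇒ `Q*` injective (`QsE_injective`) ⇒ *"QGQ* is positive"* (`inner_qgqE_pos`)
⇒ **`(QGQ*)⁻¹`** (`EE`, two-sided inverse, positive `inner_EE_pos`).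
-/

open scoped InnerProductSpace

namespace Literature.MathematicalPhysics.QuantumFieldTheory.Balaban1983to89.B6SectAVectorModelV1

open LatticeFieldCalculus B6SectADomainsV1 B6SectAZeroModesV1 B6SectAOntoV1 B6SectAOperatorsV1
open BalabanImbrieJaffe1984to88.BIJ85AxialPropagator411 (BondSpace PlaqSpace)

noncomputable section

variable {P : Params} (D : Domains P)

/-! ## §3. `Δ_a` (2.19) and its positivity -/

/-- **(2.19) `Δ_a = ∂*∂ + ∂R∂* + Q*aQ`** on vector fields. [cite: Balaban1984PropagatorsII, (2.19) p.226] -/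
def deltaAE (c : ℝ) (w : BondIdx D → ℝ) : BondSpace P →ₗ[ℝ] BondSpace P :=
  dcsE c ∘ₗ dcE c + dE c ∘ₗ RE D c ∘ₗ dsE c + QsE D ∘ₗ aE D w ∘ₗ QE D

/-- unfolding of (2.19). [cite: Balaban1984PropagatorsII, (2.19) p.226] -/
theorem deltaAE_def (c : ℝ) (w : BondIdx D → ℝ) :
    deltaAE D c w = dcsE c ∘ₗ dcE c + dE c ∘ₗ RE D c ∘ₗ dsE c + QsE D ∘ₗ aE D w ∘ₗ QE D := rfl

/-- the quadratic form of (2.19): `⟨A′, Δ_aA⟩ = ⟨∂A′, ∂A⟩ + ⟨∂*A′, R∂*A⟩ + ⟨QA′, aQA⟩`. [cite: Balaban1984PropagatorsII, (2.18)–(2.19) p.226] -/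
theorem inner_deltaAE_right (c : ℝ) (w : BondIdx D → ℝ) (x y : BondSpace P) :
    ⟪x, deltaAE D c w y⟫_ℝ = ⟪dcE c x, dcE c y⟫_ℝ + ⟪dsE c x, RE D c (dsE c y)⟫_ℝ + ⟪QE D x, aE D w (QE D y)⟫_ℝ := by
  simp only [deltaAE, LinearMap.add_apply, LinearMap.coe_comp, Function.comp_apply, inner_add_right]
  rw [real_inner_comm, inner_dcsE_left, real_inner_comm (dcE c y), real_inner_comm (dE c _), inner_dE_left,
    real_inner_comm (RE D c _), real_inner_comm (QsE D _), inner_QsE_left, real_inner_comm (aE D w _)]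

/-- `Δ_a` is symmetric. [cite: Balaban1984PropagatorsII, (2.19) p.226] -/
theorem inner_deltaAE_left (c : ℝ) (w : BondIdx D → ℝ) (x y : BondSpace P) :
    ⟪deltaAE D c w x, y⟫_ℝ = ⟪x, deltaAE D c w y⟫_ℝ := by
  rw [real_inner_comm, inner_deltaAE_right, inner_deltaAE_right, real_inner_comm (dcE c x), ← inner_RE_left,
    real_inner_comm (dsE c x), ← inner_aE_left, real_inner_comm (QE D x)]

/-- **`⟨A, Δ_aA⟩ = ‖∂A‖² + ‖R∂*A‖² + Σ_{b ∈ 𝔅} w(b)|(QA)(b)|²`**. [cite: Balaban1984PropagatorsII, (2.18)–(2.19) p.226] -/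
theorem inner_deltaAE_self (c : ℝ) (w : BondIdx D → ℝ) (x : BondSpace P) :
    ⟪x, deltaAE D c w x⟫_ℝ = ‖dcE c x‖ ^ 2 + ‖RE D c (dsE c x)‖ ^ 2 + ∑ i, w i * QE D x i ^ 2 := by
  rw [inner_deltaAE_right, real_inner_self_eq_norm_sq]
  congr 1
  · congr 1
    conv_lhs => rw [← RE_eq_self D c (RE_mem D c (dsE c x))]
    rw [← inner_RE_left, real_inner_self_eq_norm_sq]
  · rw [inner_eq_sum]
    exact Finset.sum_congr rfl fun i _ => by rw [aE_apply]; ring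

/-- `⟨A, Δ_aA⟩ ≥ 0` for `w ≥ 0`. [cite: Balaban1984PropagatorsII, (2.19) p.226] -/
theorem inner_deltaAE_self_nonneg (c : ℝ) {w : BondIdx D → ℝ} (hw : ∀ i, 0 ≤ w i) (x : BondSpace P) :
    0 ≤ ⟪x, deltaAE D c w x⟫_ℝ := by
  rw [inner_deltaAE_self]
  exact add_nonneg (add_nonneg (sq_nonneg _) (sq_nonneg _)) (Finset.sum_nonneg fun i _ => mul_nonneg (hw i) (sq_nonneg _))

/-- **The kernel of `Δ_a` is trivial** (file 2's zero-mode theorem, read on the model): `⟨A, Δ_aA⟩ = 0 ⇒ A = 0` for `c ≠ 0`,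
`w > 0` — the three squares force `∂A = 0`, `R∂*A = 0`, `QA = 0`. [cite: Balaban1984PropagatorsII, (2.19)–(2.22) p.226] -/
theorem eq_zero_of_inner_deltaAE_self_eq_zero {c : ℝ} (hc : c ≠ 0) {w : BondIdx D → ℝ} (hw : ∀ i, 0 < w i)
    {x : BondSpace P} (h : ⟪x, deltaAE D c w x⟫_ℝ = 0) : x = 0 := by
  rw [inner_deltaAE_self] at h
  have hs : 0 ≤ ∑ i, w i * QE D x i ^ 2 := Finset.sum_nonneg fun i _ => mul_nonneg (hw i).le (sq_nonneg _)
  have h1 : ‖dcE c x‖ ^ 2 = 0 := by nlinarith [sq_nonneg ‖dcE c x‖, sq_nonneg ‖RE D c (dsE c x)‖]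
  have h2 : ‖RE D c (dsE c x)‖ ^ 2 = 0 := by nlinarith [sq_nonneg ‖dcE c x‖, sq_nonneg ‖RE D c (dsE c x)‖]
  have h3 : ∑ i, w i * QE D x i ^ 2 = 0 := by nlinarith [sq_nonneg ‖dcE c x‖, sq_nonneg ‖RE D c (dsE c x)‖]
  have h1' : dcE c x = 0 := norm_eq_zero.mp (pow_eq_zero_iff two_ne_zero |>.mp h1)
  have h2' : RE D c (dsE c x) = 0 := norm_eq_zero.mp (pow_eq_zero_iff two_ne_zero |>.mp h2)
  have hcurl : curl c (WithLp.ofLp x) = 0 := funext fun p => by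
    simpa using congrArg (fun v : PlaqSpace P => v p) h1'
  have hQ : ∀ (j : ℕ) (b : PBond P j), D.LamBond j b → bondAvgIter j (WithLp.ofLp x) b = 0 := by
    refine (QE_eq_zero_iff D x).mp (PiLp.ext fun i => ?_)
    have hi := (Finset.sum_eq_zero_iff_of_nonneg fun i _ => mul_nonneg (hw i).le (sq_nonneg _)).mp h3 i (Finset.mem_univ i)
    simpa [(hw i).ne'] using hi
  have hR : ∀ μ : SiteField P 0 ℝ, D.InGauge μ → ∑ s, laplace c μ s * diverg c (WithLp.ofLp x) s = 0 := by
    intro μ hμ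
    have := (RE_eq_zero_iff D c _).mp h2' (WithLp.toLp 2 μ) ((mem_ker_QpE_iff D _).mpr hμ)
    rw [inner_eq_sum] at this
    simpa [lapE_apply] using this
  exact (WithLp.ofLp_eq_zero (p := 2)).mp (eq_zero_of_curl_constr_eq29 D hc hcurl hQ hR)

/-- **`Δ_a` IS POSITIVE DEFINITE** (p. 226; p. 228 *"The only assumption we have used was the positivity of the operator Δ_a,
a > 0"*): `⟨A, Δ_aA⟩ > 0` for `A ≠ 0`, lattice factor `c ≠ 0`, weights `w > 0`. [cite: Balaban1984PropagatorsII, (2.19)–(2.22) p.226 + p.228] -/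
theorem deltaAE_pos {c : ℝ} (hc : c ≠ 0) {w : BondIdx D → ℝ} (hw : ∀ i, 0 < w i) {x : BondSpace P} (hx : x ≠ 0) :
    0 < ⟪x, deltaAE D c w x⟫_ℝ :=
  (inner_deltaAE_self_nonneg D c (fun i => (hw i).le) x).lt_of_ne fun h =>
    hx (eq_zero_of_inner_deltaAE_self_eq_zero D hc hw h.symm)

/-- `Δ_a` is injective … [cite: Balaban1984PropagatorsII, (2.22) p.226] -/
theorem deltaAE_injective {c : ℝ} (hc : c ≠ 0) {w : BondIdx D → ℝ} (hw : ∀ i, 0 < w i) :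
    Function.Injective (deltaAE D c w) :=
  (injective_iff_map_eq_zero _).mpr fun x hx =>
    eq_zero_of_inner_deltaAE_self_eq_zero D hc hw (by rw [hx, inner_zero_right])

/-- … hence bijective (finite dimension). [cite: Balaban1984PropagatorsII, (2.22) p.226] -/
theorem deltaAE_bijective {c : ℝ} (hc : c ≠ 0) {w : BondIdx D → ℝ} (hw : ∀ i, 0 < w i) :
    Function.Bijective (deltaAE D c w) :=
  ⟨deltaAE_injective D hc hw, LinearMap.injective_iff_surjective.mp (deltaAE_injective D hc hw)⟩

/-! ## §4. `G = Δ_a⁻¹` (2.22) -/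

/-- **`G = Δ_a⁻¹`** (p. 226 *"hence the first equation implies A = G∂Rλ + GQ*ω, (2.22) where G = Δ_a⁻¹"*).
[cite: Balaban1984PropagatorsII, (2.22) p.226] -/
def GE {c : ℝ} (hc : c ≠ 0) {w : BondIdx D → ℝ} (hw : ∀ i, 0 < w i) : BondSpace P →ₗ[ℝ] BondSpace P :=
  ((LinearEquiv.ofInjectiveEndo (deltaAE D c w) (deltaAE_injective D hc hw)).symm : BondSpace P →ₗ[ℝ] BondSpace P)

/-- `GΔ_a = 1`. [cite: Balaban1984PropagatorsII, (2.22) p.226] -/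
theorem GE_comp_deltaAE {c : ℝ} (hc : c ≠ 0) {w : BondIdx D → ℝ} (hw : ∀ i, 0 < w i) :
    GE D hc hw ∘ₗ deltaAE D c w = LinearMap.id := by
  have h := LinearEquiv.ofInjectiveEndo_left_inv (deltaAE D c w) (deltaAE_injective D hc hw)
  rwa [Module.End.mul_eq_comp, Module.End.one_eq_id] at h

/-- `Δ_aG = 1`. [cite: Balaban1984PropagatorsII, (2.22) p.226] -/
theorem deltaAE_comp_GE {c : ℝ} (hc : c ≠ 0) {w : BondIdx D → ℝ} (hw : ∀ i, 0 < w i) :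
    deltaAE D c w ∘ₗ GE D hc hw = LinearMap.id := by
  have h := LinearEquiv.ofInjectiveEndo_right_inv (deltaAE D c w) (deltaAE_injective D hc hw)
  rwa [Module.End.mul_eq_comp, Module.End.one_eq_id] at h

/-- `G(Δ_aA) = A`. [cite: Balaban1984PropagatorsII, (2.22) p.226] -/
@[simp] theorem GE_deltaAE {c : ℝ} (hc : c ≠ 0) {w : BondIdx D → ℝ} (hw : ∀ i, 0 < w i) (x : BondSpace P) :
    GE D hc hw (deltaAE D c w x) = x :=
  LinearMap.congr_fun (GE_comp_deltaAE D hc hw) x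

/-- `Δ_a(Gu) = u`. [cite: Balaban1984PropagatorsII, (2.22) p.226] -/
@[simp] theorem deltaAE_GE {c : ℝ} (hc : c ≠ 0) {w : BondIdx D → ℝ} (hw : ∀ i, 0 < w i) (u : BondSpace P) :
    deltaAE D c w (GE D hc hw u) = u :=
  LinearMap.congr_fun (deltaAE_comp_GE D hc hw) u

/-- `G` is symmetric. [cite: Balaban1984PropagatorsII, (2.22) p.226] -/
theorem inner_GE_left {c : ℝ} (hc : c ≠ 0) {w : BondIdx D → ℝ} (hw : ∀ i, 0 < w i) (u v : BondSpace P) :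
    ⟪GE D hc hw u, v⟫_ℝ = ⟪u, GE D hc hw v⟫_ℝ := by
  conv_lhs => rw [← deltaAE_GE D hc hw v]
  conv_rhs => rw [← deltaAE_GE D hc hw u]
  rw [← inner_deltaAE_left]

/-- *"The operator G is positive"* (p. 228): `⟨u, Gu⟩ > 0` for `u ≠ 0`. [cite: Balaban1984PropagatorsII, p.228 before (2.35)] -/
theorem inner_GE_pos {c : ℝ} (hc : c ≠ 0) {w : BondIdx D → ℝ} (hw : ∀ i, 0 < w i) {u : BondSpace P} (hu : u ≠ 0) :
    0 < ⟪u, GE D hc hw u⟫_ℝ := by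
  have hy : GE D hc hw u ≠ 0 := fun h => hu (by rw [← deltaAE_GE D hc hw u, h, map_zero])
  have := deltaAE_pos D hc hw hy
  rwa [← inner_deltaAE_left, deltaAE_GE] at this

/-! ## §5. `Q` is onto, `Q*` is injective, `QGQ*` is invertible (p. 228) -/

/-- **`Q` is onto `L²(𝔅)`** (file 3's `exists_constr`: the multi-scale constraints (2.6)/(2.20) are independent).
[cite: Balaban1984PropagatorsII, (2.6) p.224 + (2.20) p.226] -/
theorem QE_surjective : Function.Surjective (QE D) := by
  intro ω
  obtain ⟨A, hA⟩ := exists_constr D fun j b =>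
    if h : j < D.k + 1 then (if hb : D.LamBond j b then ω ⟨⟨⟨j, h⟩, b⟩, hb⟩ else 0) else 0
  refine ⟨WithLp.toLp 2 A, PiLp.ext fun i => ?_⟩
  obtain ⟨⟨j, b⟩, hb⟩ := i
  rw [QE_apply, WithLp.ofLp_toLp, hA j b hb]
  simp only [dif_pos j.2, dif_pos hb]

/-- hence **`Q*` is injective**. [cite: Balaban1984PropagatorsII, p.228 before (2.35)] -/
theorem QsE_injective : Function.Injective (QsE D) :=
  (injective_iff_map_eq_zero _).mpr fun ω hω => by
    obtain ⟨x, hx⟩ := QE_surjective D ω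
    have h : ⟪ω, ω⟫_ℝ = 0 := by
      calc ⟪ω, ω⟫_ℝ = ⟪ω, QE D x⟫_ℝ := by rw [hx]
        _ = ⟪QsE D ω, x⟫_ℝ := (inner_QsE_left D ω x).symm
        _ = 0 := by rw [hω, inner_zero_left]
    exact inner_self_eq_zero.mp h

/-- **`QGQ*`**. [cite: Balaban1984PropagatorsII, (2.35) p.228] -/
def qgqE {c : ℝ} (hc : c ≠ 0) {w : BondIdx D → ℝ} (hw : ∀ i, 0 < w i) : BondIdxSpace D →ₗ[ℝ] BondIdxSpace D :=
  QE D ∘ₗ GE D hc hw ∘ₗ QsE D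

/-- unfolding. [cite: Balaban1984PropagatorsII, (2.35) p.228] -/
theorem qgqE_def {c : ℝ} (hc : c ≠ 0) {w : BondIdx D → ℝ} (hw : ∀ i, 0 < w i) :
    qgqE D hc hw = QE D ∘ₗ GE D hc hw ∘ₗ QsE D := rfl

/-- *"QGQ* is positive"*: `⟨ω, QGQ*ω⟩ > 0` for `ω ≠ 0`. [cite: Balaban1984PropagatorsII, p.228 before (2.35)] -/
theorem inner_qgqE_pos {c : ℝ} (hc : c ≠ 0) {w : BondIdx D → ℝ} (hw : ∀ i, 0 < w i) {ω : BondIdxSpace D} (hω : ω ≠ 0) :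
    0 < ⟪ω, qgqE D hc hw ω⟫_ℝ := by
  have hu : QsE D ω ≠ 0 := fun h => hω (QsE_injective D (by rw [h, map_zero]))
  rw [qgqE, LinearMap.comp_apply, LinearMap.comp_apply, ← inner_QsE_left]
  exact inner_GE_pos D hc hw hu

/-- `QGQ*` is injective. [cite: Balaban1984PropagatorsII, p.228 before (2.35)] -/
theorem qgqE_injective {c : ℝ} (hc : c ≠ 0) {w : BondIdx D → ℝ} (hw : ∀ i, 0 < w i) :
    Function.Injective (qgqE D hc hw) :=
  (injective_iff_map_eq_zero _).mpr fun ω hω => by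
    by_contra hne
    have := inner_qgqE_pos D hc hw hne
    rw [hω, inner_zero_right] at this
    exact lt_irrefl 0 this

/-- **`(QGQ*)⁻¹`** (*"an inverse is a well-defined and positive operator"*, p. 228). [cite: Balaban1984PropagatorsII, (2.35) p.228] -/
def EE {c : ℝ} (hc : c ≠ 0) {w : BondIdx D → ℝ} (hw : ∀ i, 0 < w i) : BondIdxSpace D →ₗ[ℝ] BondIdxSpace D :=
  ((LinearEquiv.ofInjectiveEndo (qgqE D hc hw) (qgqE_injective D hc hw)).symm : BondIdxSpace D →ₗ[ℝ] BondIdxSpace D)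

/-- `(QGQ*)⁻¹(QGQ*) = 1`. [cite: Balaban1984PropagatorsII, (2.35) p.228] -/
theorem EE_comp {c : ℝ} (hc : c ≠ 0) {w : BondIdx D → ℝ} (hw : ∀ i, 0 < w i) :
    EE D hc hw ∘ₗ (QE D ∘ₗ GE D hc hw ∘ₗ QsE D) = LinearMap.id := by
  have h := LinearEquiv.ofInjectiveEndo_left_inv (qgqE D hc hw) (qgqE_injective D hc hw)
  rwa [Module.End.mul_eq_comp, Module.End.one_eq_id] at h

/-- `(QGQ*)(QGQ*)⁻¹ = 1`. [cite: Balaban1984PropagatorsII, (2.35) p.228] -/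
theorem comp_EE {c : ℝ} (hc : c ≠ 0) {w : BondIdx D → ℝ} (hw : ∀ i, 0 < w i) :
    (QE D ∘ₗ GE D hc hw ∘ₗ QsE D) ∘ₗ EE D hc hw = LinearMap.id := by
  have h := LinearEquiv.ofInjectiveEndo_right_inv (qgqE D hc hw) (qgqE_injective D hc hw)
  rwa [Module.End.mul_eq_comp, Module.End.one_eq_id] at h

/-- *"… and positive"*: `⟨B, (QGQ*)⁻¹B⟩ > 0` for `B ≠ 0`. [cite: Balaban1984PropagatorsII, p.228 before (2.35)] -/
theorem inner_EE_pos {c : ℝ} (hc : c ≠ 0) {w : BondIdx D → ℝ} (hw : ∀ i, 0 < w i) {B : BondIdxSpace D} (hB : B ≠ 0) :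
    0 < ⟪B, EE D hc hw B⟫_ℝ := by
  have hB' : qgqE D hc hw (EE D hc hw B) = B := LinearMap.congr_fun (comp_EE D hc hw) B
  have hne : EE D hc hw B ≠ 0 := fun h => hB (by rw [← hB', h, map_zero])
  have hpos := inner_qgqE_pos D hc hw hne
  -- `⟨E B, QGQ* E B⟩ = ⟨E B, B⟩ = ⟨B, E B⟩`
  rwa [hB', real_inner_comm] at hpos


end

end Literature.MathematicalPhysics.QuantumFieldTheory.Balaban1983to89.B6SectAVectorModelV1
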